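import Summits.QuantumFields.YangMills.Theorems.BalabanLadderUVSeamRecCeilingsPeriodClasses
import Mathlib.Algebra.Order.Field.GeomSum
import HarnessLib

/-!
# Crux `UVSeamRec` (stmt-QuantumFields-20043), v5(α) stub `stub_responseMomentsOdd6` (RM): LEVEL CAPS of tempered-d1's influence
# coefficients — `Σ_i c_{iγ} ≤ Λ_k := 16(b^k/(R+2+2b^k))⁴` at level `k`, `Σ_k Λ_k ≤ 1` — and the period fold of ONE LEVEL of the family shell

Helper file (`--supports stmt-QuantumFields-20043`) of the width-lever seat `ym-20043-ceilings-p2` (lane B, gen 3); sequel of this seat's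
`…CeilingsPeriodClasses.lean` (p546436) and companion of `…CeilingsPolymerRarityLevelwise.lean` (levelwise Hölder composition).  It supplies the
two geometric inputs of the levelwise composition in tempered-d1's vocabulary (`PolymerData`: `shell`, `influenceCoeff = (b^k/dist_∞)⁴`,
`familyShell`, `familyCoeff`): §1 the LEVEL CAP — a polymer of level `k` in a shell has coefficient `≤ (b^k/(R+2+2b^k))⁴` (`dist ≥ R+2+2b^k`), a
period class meets at most `16` cyclically separated shells (p546436's cyclic pigeonhole), so the fibre-summed family coefficients of a class of
level `k` total at most `Λ_k = 16(b^k/(R+2+2b^k))⁴` (at the top level `2b^k ≈ R` this is tempered-d1's `Λ = 1`; it decays like `b^{−4(kmax−k)}`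
below); §2 `Σ_{k ≤ kmax, 2b^k ≤ R} Λ_k ≤ 1/16 + 1/80 ≤ 1` (only levels with `2b^k ≤ R` occur in a shell); §3 the PERIOD FOLD OF A SUBFAMILY
(e.g. one level of the family shell) with a prescribed clause-(ii) cap and the density budget transferred CUBE BY CUBE
(`exists_polymerSystem_of_periodFree_sub`, the level-local form of p546436's `exists_polymerSystem_of_periodFree`).  HONEST FRAMING: bookkeeping
for the OPEN block-level product laws of the (β) architecture of (RM); nothing of E0′; not a gap, not Clay.

References: folklore.
-/

set_option autoImplicit false

noncomputable section

open MeasureTheory Filter Topology Finset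
open Literature.Probability.LatticeModels
open Literature.MathematicalPhysics.QuantumFieldTheory (GaugeConfig LatticeRep)
open Literature.MathematicalPhysics.QuantumLattice

namespace Summit.QuantumFields.YangMills.Cruxes.UVSeamRec.TemperedResponse

open Summit.QuantumFields.YangMills.Cruxes.OSLegsFromFemtoAndGap.DlrCollarTransfer
open Summit.QuantumFields.YangMills.Cruxes.UVSeamRec.PolymerData

/-! ## §1 The level cap of the influence coefficients -/

section LevelCap

/-- A polymer of level `k` in the shell of the radius-`(R+1)` cube around `x` has influence coefficient
`(b^k/dist_∞)⁴ ≤ (b^k/(R+2+2b^k))⁴` (shell condition `dist_∞ ≥ R+2+2b^k`). [folklore] -/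
theorem influenceCoeff_le_levelCap_of_mem_shell (𝔟 : BlockSize) {kmax R : ℕ} {x : Fin 4 → ℤ} {γ : Polymer}
    (h : γ ∈ shell 𝔟 kmax R x) :
    influenceCoeff 𝔟 γ x ≤ ((𝔟.b : ℝ) ^ γ.k / ((R : ℝ) + 2 + 2 * (𝔟.b : ℝ) ^ γ.k)) ^ 4 := by
  have hd : ((R + 2 + 2 * 𝔟.b ^ γ.k : ℕ) : ℝ) ≤ (PolymerData.supDist x (anchor 𝔟 γ) : ℝ) := by
    exact_mod_cast le_supDist_of_mem_shell h
  push_cast at hd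
  have hbk : (0 : ℝ) < (𝔟.b : ℝ) ^ γ.k := by
    have := 𝔟.pos
    positivity
  have hden : (0 : ℝ) < (R : ℝ) + 2 + 2 * (𝔟.b : ℝ) ^ γ.k := by positivity
  unfold influenceCoeff
  refine pow_le_pow_left₀ (by positivity) ?_ 4
  exact div_le_div_of_nonneg_left hbk.le hden hd

/-- The fibre of a period class `v` inside any polymer set, read by cube `i`: the fibre-summed family coefficient is at most the level cap of
the class's level `v.1` if the class meets the shell of cube `i`, and `0` otherwise (a class meets one shell at most once, p546436). [folklore] -/
theorem sum_fiber_familyCoeff_le_levelCap (𝔟 : BlockSize) (kmax R : ℕ) {n L : ℕ} (hRL : 4 * R + 8 ≤ L)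
    (x : Fin n → (Fin 4 → ℤ)) (S : Finset Polymer) (v : ℕ × (Fin 4 → ZMod (2 * L + 1)) × Fin 4 × Fin 4) (i : Fin n) :
    ∑ γ ∈ S.filter (fun γ => (γ.k, Torus.proj (2 * L + 1) (anchor 𝔟 γ), γ.μ, γ.ν) = v), familyCoeff 𝔟 kmax R x i γ ≤
      if ∃ γ ∈ shell 𝔟 kmax R (x i), (γ.k, Torus.proj (2 * L + 1) (anchor 𝔟 γ), γ.μ, γ.ν) = v then
        ((𝔟.b : ℝ) ^ v.1 / ((R : ℝ) + 2 + 2 * (𝔟.b : ℝ) ^ v.1)) ^ 4 else 0 := by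
  classical
  have hsum : ∑ γ ∈ S.filter (fun γ => (γ.k, Torus.proj (2 * L + 1) (anchor 𝔟 γ), γ.μ, γ.ν) = v),
      familyCoeff 𝔟 kmax R x i γ =
      ∑ γ ∈ (S.filter (fun γ => (γ.k, Torus.proj (2 * L + 1) (anchor 𝔟 γ), γ.μ, γ.ν) = v)).filter
        (fun γ => γ ∈ shell 𝔟 kmax R (x i)), influenceCoeff 𝔟 γ (x i) := by
    rw [Finset.sum_filter (p := fun γ => γ ∈ shell 𝔟 kmax R (x i))]
    rfl
  rw [hsum]
  set F := (S.filter (fun γ => (γ.k, Torus.proj (2 * L + 1) (anchor 𝔟 γ), γ.μ, γ.ν) = v)).filter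
    (fun γ => γ ∈ shell 𝔟 kmax R (x i)) with hF
  have hcard : F.card ≤ 1 := by
    refine Finset.card_le_one.2 fun γ hγ γ' hγ' => ?_
    have h1 := Finset.mem_filter.1 hγ
    have h2 := Finset.mem_filter.1 hγ'
    exact eq_of_mem_shell_of_periodClass_eq 𝔟 hRL h1.2 h2.2 ((Finset.mem_filter.1 h1.1).2.trans
      (Finset.mem_filter.1 h2.1).2.symm)
  have hterm : ∀ γ ∈ F, influenceCoeff 𝔟 γ (x i) ≤ ((𝔟.b : ℝ) ^ v.1 / ((R : ℝ) + 2 + 2 * (𝔟.b : ℝ) ^ v.1)) ^ 4 := by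
    intro γ hγ
    have h1 := Finset.mem_filter.1 hγ
    have hk : γ.k = v.1 := by
      have := (Finset.mem_filter.1 h1.1).2
      rw [← this]
    rw [← hk]
    exact influenceCoeff_le_levelCap_of_mem_shell 𝔟 h1.2
  have hle : ∑ γ ∈ F, influenceCoeff 𝔟 γ (x i) ≤
      F.card • ((𝔟.b : ℝ) ^ v.1 / ((R : ℝ) + 2 + 2 * (𝔟.b : ℝ) ^ v.1)) ^ 4 := Finset.sum_le_card_nsmul _ _ _ hterm
  have hcap0 : (0 : ℝ) ≤ ((𝔟.b : ℝ) ^ v.1 / ((R : ℝ) + 2 + 2 * (𝔟.b : ℝ) ^ v.1)) ^ 4 := by positivity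
  split_ifs with hex
  · refine hle.trans ?_
    rw [nsmul_eq_mul]
    have : (F.card : ℝ) ≤ 1 := by exact_mod_cast hcard
    nlinarith
  · have hempty : F = ∅ := by
      refine Finset.eq_empty_of_forall_notMem fun γ hγ => hex ?_
      have h1 := Finset.mem_filter.1 hγ
      exact ⟨γ, h1.2, (Finset.mem_filter.1 h1.1).2⟩
    rw [hempty, Finset.sum_empty]

/-- **THE LEVEL CAP OF CLAUSE (ii).**  For a cube family pairwise cyclically `2R+4`-separated (`4R+8 ≤ L`) and a period class `v` of
level `k = v.1`: the fibre-summed family coefficients total `Σ_i Σ_{γ ∈ S, class γ = v} familyCoeff i γ ≤ 16 · (b^k/(R+2+2b^k))⁴` (at most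
`16` shells meet the class, p546436 `card_filter_shell_meets_class_le`). [folklore] -/
theorem sum_sum_fiber_familyCoeff_le_levelCap (𝔟 : BlockSize) (kmax R : ℕ) {n L : ℕ} (hRL : 4 * R + 8 ≤ L)
    (x : Fin n → (Fin 4 → ℤ))
    (hsep : ∀ i j : Fin n, i ≠ j → ∃ k : Fin 4,
      (2 * (R : ℤ) + 4) ≤ |((((x i k - x j k : ℤ) : ZMod (2 * L + 1))).valMinAbs : ℤ)|)
    (S : Finset Polymer) (v : ℕ × (Fin 4 → ZMod (2 * L + 1)) × Fin 4 × Fin 4) :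
    ∑ i, ∑ γ ∈ S.filter (fun γ => (γ.k, Torus.proj (2 * L + 1) (anchor 𝔟 γ), γ.μ, γ.ν) = v),
        familyCoeff 𝔟 kmax R x i γ ≤
      16 * ((𝔟.b : ℝ) ^ v.1 / ((R : ℝ) + 2 + 2 * (𝔟.b : ℝ) ^ v.1)) ^ 4 := by
  classical
  have h1 : ∑ i, ∑ γ ∈ S.filter (fun γ => (γ.k, Torus.proj (2 * L + 1) (anchor 𝔟 γ), γ.μ, γ.ν) = v),
      familyCoeff 𝔟 kmax R x i γ ≤
      ∑ i : Fin n, if ∃ γ ∈ shell 𝔟 kmax R (x i), (γ.k, Torus.proj (2 * L + 1) (anchor 𝔟 γ), γ.μ, γ.ν) = v then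
        ((𝔟.b : ℝ) ^ v.1 / ((R : ℝ) + 2 + 2 * (𝔟.b : ℝ) ^ v.1)) ^ 4 else 0 :=
    Finset.sum_le_sum fun i _ => sum_fiber_familyCoeff_le_levelCap 𝔟 kmax R hRL x S v i
  refine h1.trans ?_
  rw [← Finset.sum_filter, Finset.sum_const, nsmul_eq_mul]
  have hc := card_filter_shell_meets_class_le 𝔟 kmax R hRL x hsep v
  have : ((Finset.univ.filter fun i => ∃ γ ∈ shell 𝔟 kmax R (x i),
      (γ.k, Torus.proj (2 * L + 1) (anchor 𝔟 γ), γ.μ, γ.ν) = v).card : ℝ) ≤ 16 := by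
    exact_mod_cast hc
  have hcap0 : (0 : ℝ) ≤ ((𝔟.b : ℝ) ^ v.1 / ((R : ℝ) + 2 + 2 * (𝔟.b : ℝ) ^ v.1)) ^ 4 := by positivity
  nlinarith

end LevelCap

/-! ## §2 The level caps are summable: `Σ_{k ≤ kmax, 2b^k ≤ R} 16(b^k/(R+2+2b^k))⁴ ≤ 1` -/

section CapSum

/-- **SUMMABILITY OF THE LEVEL CAPS.**  Over the levels that occur in a shell (`k ≤ kmax`, `2b^k ≤ R`):
`Σ_k 16(b^k/(R+2+2b^k))⁴ ≤ 1` — the top such level `K` contributes `≤ 16·(1/4)⁴ = 1/16` (`R+2+2b^K ≥ 4b^K`), level `k < K` contributes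
`≤ (b^k/b^K)⁴ = b^{−4(K−k)}` (`R+2+2b^k ≥ 2b^K`), and `Σ_{j≥1} b^{−4j} ≤ 1/80` for `b ≥ 3`. [folklore] -/
theorem sum_levelCap_le_one (𝔟 : BlockSize) (kmax R : ℕ) :
    ∑ k ∈ (Finset.range (kmax + 1)).filter (fun k => 2 * 𝔟.b ^ k ≤ R),
      16 * ((𝔟.b : ℝ) ^ k / ((R : ℝ) + 2 + 2 * (𝔟.b : ℝ) ^ k)) ^ 4 ≤ 1 := by
  classical
  set K' := (Finset.range (kmax + 1)).filter (fun k => 2 * 𝔟.b ^ k ≤ R) with hK'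
  set f : ℕ → ℝ := fun k => 16 * ((𝔟.b : ℝ) ^ k / ((R : ℝ) + 2 + 2 * (𝔟.b : ℝ) ^ k)) ^ 4 with hf
  have hb : (3 : ℝ) ≤ (𝔟.b : ℝ) := by
    have h1 := 𝔟.hb.2
    have h2 := 𝔟.hb.1
    have : 3 ≤ 𝔟.b := by
      rcases h2 with ⟨m, hm⟩
      omega
    exact_mod_cast this
  have hbpos : (0 : ℝ) < (𝔟.b : ℝ) := by linarith
  have hf0 : ∀ k, 0 ≤ f k := fun k => by
    simp only [hf]
    positivity
  rcases K'.eq_empty_or_nonempty with hK | hK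
  · rw [hK, Finset.sum_empty]; norm_num
  -- the top occurring level
  set Kx := K'.max' hK with hKx
  have hKxmem : Kx ∈ K' := Finset.max'_mem K' hK
  have hKxR : 2 * 𝔟.b ^ Kx ≤ R := (Finset.mem_filter.1 hKxmem).2
  have hKxR' : 2 * (𝔟.b : ℝ) ^ Kx ≤ (R : ℝ) := by exact_mod_cast hKxR
  have hsub : K' ⊆ Finset.range (Kx + 1) := fun k hk =>
    Finset.mem_range.2 (Nat.lt_succ_of_le (Finset.le_max' K' k hk))
  have hstep1 : ∑ k ∈ K', f k ≤ ∑ k ∈ Finset.range (Kx + 1), f k :=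
    Finset.sum_le_sum_of_subset_of_nonneg hsub fun k _ _ => hf0 k
  refine hstep1.trans ?_
  rw [Finset.sum_range_succ]
  -- the top level contributes at most `1/16`
  have htop : f Kx ≤ 1 / 16 := by
    simp only [hf]
    have hbK : (0 : ℝ) < (𝔟.b : ℝ) ^ Kx := by positivity
    have hratio : (𝔟.b : ℝ) ^ Kx / ((R : ℝ) + 2 + 2 * (𝔟.b : ℝ) ^ Kx) ≤ 1 / 4 := by
      rw [div_le_iff₀ (by positivity)]
      nlinarith
    have h0 : (0 : ℝ) ≤ (𝔟.b : ℝ) ^ Kx / ((R : ℝ) + 2 + 2 * (𝔟.b : ℝ) ^ Kx) := by positivity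
    calc 16 * ((𝔟.b : ℝ) ^ Kx / ((R : ℝ) + 2 + 2 * (𝔟.b : ℝ) ^ Kx)) ^ 4 ≤ 16 * (1 / 4 : ℝ) ^ 4 := by
          gcongr
      _ = 1 / 16 := by norm_num
  -- the lower levels contribute a geometric series
  set y : ℝ := ((𝔟.b : ℝ) ^ 4)⁻¹ with hy
  have hy0 : 0 ≤ y := by positivity
  have hy81 : y ≤ 1 / 81 := by
    simp only [hy]
    rw [inv_le_comm₀ (by positivity) (by norm_num)]
    nlinarith [pow_le_pow_left₀ (by norm_num : (0 : ℝ) ≤ 3) hb 4]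
  have hy1 : y < 1 := by linarith
  have hlow : ∀ k ∈ Finset.range Kx, f k ≤ y ^ (Kx - k) := by
    intro k hk
    have hkK : k < Kx := Finset.mem_range.1 hk
    simp only [hf]
    have hbk : (0 : ℝ) < (𝔟.b : ℝ) ^ k := by positivity
    have hbK : (0 : ℝ) < (𝔟.b : ℝ) ^ Kx := by positivity
    -- ratio ≤ b^k / (2 b^Kx)
    have hratio : (𝔟.b : ℝ) ^ k / ((R : ℝ) + 2 + 2 * (𝔟.b : ℝ) ^ k) ≤ (𝔟.b : ℝ) ^ k / (2 * (𝔟.b : ℝ) ^ Kx) :=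
      div_le_div_of_nonneg_left hbk.le (by positivity) (by linarith)
    have h0 : (0 : ℝ) ≤ (𝔟.b : ℝ) ^ k / ((R : ℝ) + 2 + 2 * (𝔟.b : ℝ) ^ k) := by positivity
    have hpow : (𝔟.b : ℝ) ^ Kx = (𝔟.b : ℝ) ^ k * (𝔟.b : ℝ) ^ (Kx - k) := by
      rw [← pow_add, Nat.add_sub_cancel' hkK.le]
    calc 16 * ((𝔟.b : ℝ) ^ k / ((R : ℝ) + 2 + 2 * (𝔟.b : ℝ) ^ k)) ^ 4
        ≤ 16 * ((𝔟.b : ℝ) ^ k / (2 * (𝔟.b : ℝ) ^ Kx)) ^ 4 := by gcongr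
      _ = (((𝔟.b : ℝ) ^ (Kx - k)) ^ 4)⁻¹ := by
          rw [hpow]
          field_simp
          ring
      _ = y ^ (Kx - k) := by
          simp only [hy]
          rw [← pow_mul, mul_comm, pow_mul, inv_pow]
  have hgeom : ∑ k ∈ Finset.range Kx, f k ≤ 1 / 80 := by
    refine (Finset.sum_le_sum hlow).trans ?_
    -- reflect: Σ_{k<Kx} y^{Kx−k} = Σ_{j<Kx} y^{j+1} = y · Σ_{j<Kx} y^j
    have hrefl : ∑ k ∈ Finset.range Kx, y ^ (Kx - k) = ∑ j ∈ Finset.range Kx, y ^ (j + 1) := by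
      rw [← Finset.sum_range_reflect (fun j => y ^ (j + 1)) Kx]
      refine Finset.sum_congr rfl fun k hk => ?_
      have hkK : k < Kx := Finset.mem_range.1 hk
      congr 1
      omega
    rw [hrefl]
    have hgs : ∑ j ∈ Finset.range Kx, y ^ j ≤ 1 / (1 - y) := by
      have := geom_sum_Ico_le_of_lt_one (m := 0) (n := Kx) hy0 hy1
      rw [pow_zero, ← Finset.range_eq_Ico] at this
      exact this
    have hfac : ∑ j ∈ Finset.range Kx, y ^ (j + 1) = y * ∑ j ∈ Finset.range Kx, y ^ j := by
      rw [Finset.mul_sum]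
      exact Finset.sum_congr rfl fun j _ => by ring
    rw [hfac]
    calc y * ∑ j ∈ Finset.range Kx, y ^ j ≤ y * (1 / (1 - y)) := mul_le_mul_of_nonneg_left hgs hy0
      _ ≤ 1 / 80 := by
          rw [mul_one_div, div_le_iff₀ (by linarith)]
          linarith
  linarith

end CapSum

/-! ## §3 The period fold of a subfamily of the family shell with a prescribed clause-(ii) cap -/

section FoldSub

variable {N : ℕ} [NeZero N]

/-- **THE PERIOD FOLD OF A SUBFAMILY.**  Structure group `SU(N)`, any `r`, block size `𝔟`, thresholds `ε`, cutoff `kmax`, odd torus `2L+1`,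
cube family `x` with `4R+8 ≤ L`; a subfamily `S₀ ⊆ familyShell 𝔟 kmax R x` (e.g. one level of it) whose fibre-summed family coefficients are
capped, `Σ_i Σ_{γ∈S₀, class γ = v} familyCoeff i γ ≤ Λ₀` for every period class `v`; weights `w γ` on `S₀`; the product law
`⟨∏_{γ∈A} 1_{largeFieldEvent 𝔟 (ε γ.k) γ}∘lift⟩ ≤ ∏_{γ∈A} w γ` for the PERIOD-FREE `A ⊆ S₀`.  THEN there is a polymer system `(S, E, w, c)` with
`S ⊆ S₀` and nonnegative coefficients, DOMINATING `Σ_{γ∈S₀} familyCoeff i γ · 1_{E_γ}∘lift` for every cube `i`, with clause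
(ii) `Σ_i c i s ≤ Λ₀`, the density budget transferred CUBE BY CUBE (`Σ_{s∈S} c i s · w s ≤ Σ_{γ∈S₀} familyCoeff i γ · w γ`) and the product law on
ALL `A ⊆ S` (representatives = `w`-minimisers of the period classes of `S₀`; coefficients = fibre sums). [folklore] -/
theorem exists_polymerSystem_of_periodFree_sub (r : LatticeRep (Matrix.specialUnitaryGroup (Fin N) ℂ)) (𝔟 : BlockSize)
    (ε : ℕ → ℝ) (kmax R L : ℕ) (β : ℝ) {n : ℕ} (x : Fin n → (Fin 4 → ℤ))
    (S₀ : Finset Polymer) {Λ₀ : ℝ}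
    (hcap : ∀ v : ℕ × (Fin 4 → ZMod (2 * L + 1)) × Fin 4 × Fin 4,
      ∑ i, ∑ γ ∈ S₀.filter (fun γ => (γ.k, Torus.proj (2 * L + 1) (anchor 𝔟 γ), γ.μ, γ.ν) = v),
        familyCoeff 𝔟 kmax R x i γ ≤ Λ₀)
    (w : Polymer → ℝ)
    (hpl : ∀ A, A ⊆ S₀ → Set.InjOn (fun γ : Polymer => (γ.k, Torus.proj (2 * L + 1) (anchor 𝔟 γ), γ.μ, γ.ν)) ↑A →
      torusE (Matrix.specialUnitaryGroup (Fin N) ℂ) r β L (fun U => ∏ γ ∈ A,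
        (largeFieldEvent (N := N) 𝔟 (ε γ.k) γ).indicator (fun _ => (1 : ℝ)) U) ≤ ∏ γ ∈ A, w γ) :
    ∃ (S : Finset Polymer) (c : Fin n → Polymer → ℝ),
      S ⊆ S₀ ∧ (∀ i, ∀ γ ∈ S, 0 ≤ c i γ) ∧
      (∀ (i : Fin n) (U : GaugeConfig 4 (2 * L + 1) (Matrix.specialUnitaryGroup (Fin N) ℂ)),
        ∑ γ ∈ S₀, familyCoeff 𝔟 kmax R x i γ *
            (largeFieldEvent (N := N) 𝔟 (ε γ.k) γ).indicator (fun _ => (1 : ℝ)) (torusLift (2 * L + 1) U) ≤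
          ∑ γ ∈ S, c i γ * (largeFieldEvent (N := N) 𝔟 (ε γ.k) γ).indicator (fun _ => (1 : ℝ)) (torusLift (2 * L + 1) U)) ∧
      (∀ γ ∈ S, ∑ i, c i γ ≤ Λ₀) ∧
      (∀ i, ∑ γ ∈ S, c i γ * w γ ≤ ∑ γ ∈ S₀, familyCoeff 𝔟 kmax R x i γ * w γ) ∧
      (∀ A, A ⊆ S → torusE (Matrix.specialUnitaryGroup (Fin N) ℂ) r β L (fun U => ∏ γ ∈ A,
        (largeFieldEvent (N := N) 𝔟 (ε γ.k) γ).indicator (fun _ => (1 : ℝ)) U) ≤ ∏ γ ∈ A, w γ) := by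
  classical
  set pc : Polymer → ℕ × (Fin 4 → ZMod (2 * L + 1)) × Fin 4 × Fin 4 :=
    (fun γ : Polymer => (γ.k, Torus.proj (2 * L + 1) (anchor 𝔟 γ), γ.μ, γ.ν)) with hpc
  -- the period classes present in `S₀` and their fibres
  set V := S₀.image pc with hV
  have hfib : ∀ v ∈ V, (S₀.filter fun γ => pc γ = v).Nonempty := by
    intro v hv
    obtain ⟨γ, hγ, rfl⟩ := Finset.mem_image.1 hv
    exact ⟨γ, Finset.mem_filter.2 ⟨hγ, rfl⟩⟩
  -- one `w`-minimising representative per class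
  set ρ : (ℕ × (Fin 4 → ZMod (2 * L + 1)) × Fin 4 × Fin 4) → Polymer := fun v =>
    if h : (S₀.filter fun γ => pc γ = v).Nonempty then
      Classical.choose (Finset.exists_min_image (S₀.filter fun γ => pc γ = v) w h)
    else ⟨0, 0, 0, 1, by decide⟩ with hρ
  have hρspec : ∀ v ∈ V, ρ v ∈ S₀ ∧ pc (ρ v) = v ∧ ∀ γ ∈ S₀, pc γ = v → w (ρ v) ≤ w γ := by
    intro v hv
    have h := hfib v hv
    have hs := Classical.choose_spec (Finset.exists_min_image (S₀.filter fun γ => pc γ = v) w h)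
    have hρv : ρ v = Classical.choose (Finset.exists_min_image (S₀.filter fun γ => pc γ = v) w h) := by
      simp only [hρ, dif_pos h]
    rw [hρv]
    refine ⟨(Finset.mem_filter.1 hs.1).1, (Finset.mem_filter.1 hs.1).2, fun γ hγ hγv => hs.2 γ ?_⟩
    exact Finset.mem_filter.2 ⟨hγ, hγv⟩
  have hρinj : Set.InjOn ρ ↑V := by
    intro v₁ hv₁ v₂ hv₂ h
    rw [← (hρspec v₁ hv₁).2.1, ← (hρspec v₂ hv₂).2.1, h]
  -- the folded system
  set S : Finset Polymer := V.image ρ with hS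
  set c : Fin n → Polymer → ℝ := fun i s => ∑ γ ∈ S₀.filter (fun γ => pc γ = pc s), familyCoeff 𝔟 kmax R x i γ with hc
  have hSsub : S ⊆ S₀ := by
    intro s hs
    obtain ⟨v, hv, rfl⟩ := Finset.mem_image.1 hs
    exact (hρspec v hv).1
  have hSinj : Set.InjOn pc ↑S := by
    intro s₁ hs₁ s₂ hs₂ h
    obtain ⟨v₁, hv₁, rfl⟩ := Finset.mem_image.1 (Finset.mem_coe.1 hs₁)
    obtain ⟨v₂, hv₂, rfl⟩ := Finset.mem_image.1 (Finset.mem_coe.1 hs₂)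
    rw [(hρspec v₁ hv₁).2.1, (hρspec v₂ hv₂).2.1] at h
    rw [h]
  have hmaps : ∀ γ ∈ S₀, pc γ ∈ V := fun γ hγ => Finset.mem_image_of_mem pc hγ
  refine ⟨S, c, hSsub, fun i s _ => Finset.sum_nonneg fun γ _ => familyCoeff_nonneg 𝔟 kmax R x i γ, ?_, ?_, ?_, ?_⟩
  · -- domination: an identity after folding along the period classes
    intro i U
    rw [← Finset.sum_fiberwise_of_maps_to hmaps, hS, Finset.sum_image hρinj]
    refine Finset.sum_le_sum fun v hv => ?_
    have hρv := (hρspec v hv).2.1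
    have hfibre : ∑ γ ∈ S₀.filter (fun γ => pc γ = v), familyCoeff 𝔟 kmax R x i γ *
        (largeFieldEvent (N := N) 𝔟 (ε γ.k) γ).indicator (fun _ => (1 : ℝ)) (torusLift (2 * L + 1) U) =
        (∑ γ ∈ S₀.filter (fun γ => pc γ = v), familyCoeff 𝔟 kmax R x i γ) *
          (largeFieldEvent (N := N) 𝔟 (ε (ρ v).k) (ρ v)).indicator (fun _ => (1 : ℝ)) (torusLift (2 * L + 1) U) := by
      rw [Finset.sum_mul]
      refine Finset.sum_congr rfl fun γ hγ => ?_
      rw [indicator_largeFieldEvent_torusLift_eq_of_periodClass_eq (N := N) 𝔟 ε L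
        (((Finset.mem_filter.1 hγ).2).trans hρv.symm) U]
    rw [hfibre]
    refine le_of_eq ?_
    simp only [hc, hρv]
  · -- clause (ii) with the prescribed cap
    intro s _
    simp only [hc]
    exact hcap (pc s)
  · -- the density budget, cube by cube
    intro i
    rw [hS, Finset.sum_image hρinj]
    have hstep : ∀ v ∈ V, c i (ρ v) * w (ρ v) ≤
        ∑ γ ∈ S₀.filter (fun γ => pc γ = v), familyCoeff 𝔟 kmax R x i γ * w γ := by
      intro v hv
      have hρv := (hρspec v hv).2.1
      simp only [hc, hρv]
      rw [Finset.sum_mul]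
      refine Finset.sum_le_sum fun γ hγ => ?_
      exact mul_le_mul_of_nonneg_left ((hρspec v hv).2.2 γ (Finset.mem_filter.1 hγ).1 (Finset.mem_filter.1 hγ).2)
        (familyCoeff_nonneg 𝔟 kmax R x i γ)
    refine (Finset.sum_le_sum hstep).trans ?_
    rw [Finset.sum_fiberwise_of_maps_to hmaps]
  · -- the product law on the folded (period-free) system
    intro A hA
    exact hpl A (hA.trans hSsub) (hSinj.mono (Finset.coe_subset.2 hA))

end FoldSub

end Summit.QuantumFields.YangMills.Cruxes.UVSeamRec.TemperedResponse

end
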